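import Summits.Parity.GeneralizedHardyLittlewood.Theorems.FordMaynardNoSieveConst0164NegWitness0164StepData
import Summits.Parity.GeneralizedHardyLittlewood.Theorems.FordMaynardNoSieveConst0164NegWitness0164LinnikFive

/-!
# Route `FordMaynardNoSieveConst0164`, crux `NegWitness0164` (stmt-Parity-19102), line `birth`,
# stub `stub_tweakNeg0164`: the two remaining numerical facts in closed form

Helper file toward the certificate stub (K. Ford, J. Maynard, *On the theory of prime producing sieves*,
arXiv:2407.14368, §8).  After `stub_tweakNeg0164_of_shape''` (`…FamilyOne`) the stub needs, for a witness of the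
Ford–Maynard / class-R shape with `F₀⁽³⁾ = F₀⁽⁴⁾ = -𝟙[ν ≤ xᵢ < 1/2]` (`ν = 41/250`), exactly two numerical facts.
This file writes both in closed form, free of `blockWeight`/`𝓛`:

* `T3_eq_neg_third_J3_0164` — the three-piece term of `h(1)` is `T₃ = -(1/3)·J₃`,
  `J₃ = ∫_{v ∈ Δ₃(1)} 𝟙[ν ≤ vᵢ < 1/2]/(v₀v₁v₂)` (Ford–Maynard's `I₃ = -2∫_{ordered}`; numerically `J₃ = 2.5705`,
  `T₃ = -0.85684`);
* `S5_eq_0164` — the five-piece term is `S₅ = -(1/20) ∫_{v ∈ Δ₅(1)} 𝟙[v ≥ ν] F₀⁽⁵⁾(v)/∏v` for `F₀⁽⁵⁾` vanishing at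
  vectors with a pair `≥ 1/2` (`𝓛_{1/2} = -6` there, `blockWeight_five_eq`);
* `pieceTwo_family_two_eq_0164` — the `n = 2` piece of `f_{2,1}` is `(1/2)∫_{Δ₂(α)} 𝟙[ν ≤ vᵢ < 1/2]/(v₀v₁)`
  (Ford–Maynard's `F₄(α)/α`), and `pieceThree_family_two_eq_0164` — the `n = 3` piece is
  `-(1/6) ∫_{Δ₃(α)} 𝟙[v ≥ ν] F₀⁽⁵⁾(v, b)/(v₀v₁v₂)`;
* `stub_tweakNeg0164_of_explicit` — **the stub from the shape plus the two explicit inequalities**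
  (I) `J₃/3 + (1/20)∫_{Δ₅(1)} 𝟙 F₀⁽⁵⁾/∏v > 1` and
  (II) `∀ b ∈ [ν,1/2)², |b| ≤ 1/2, α = 1-|b|: (α/6)∫_{Δ₃(α)} 𝟙 F₀⁽⁵⁾(v,b)/∏v ≤ 1 + (α/2)∫_{Δ₂(α)} 𝟙[ν ≤ vᵢ < 1/2]/(v₀v₁)`.

Def-free.  References: [FordMaynard2024PrimeSieves] arXiv:2407.14368, §8 (proof of Theorem 2.7 (c): I₃, I₅, F₄, F₅).
-/

noncomputable section

open Finset MeasureTheory Set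
open scoped Classical
open Literature.Combinatorics.Enumerative
open Literature.NumberTheory.Sieve Literature.NumberTheory.Sieve.FordMaynard

namespace Summit.Parity.GeneralizedHardyLittlewood.FordMaynardNoSieveConst0164NegWitness0164

/-- **`T₃ = -(1/3) J₃`** for data with `F₀⁽³⁾ = -1` at the small vectors of the support.
[cite: FordMaynard2024PrimeSieves, §8 ("I₃ = −2∫ dx/(x₁x₂x₃)")] -/
theorem T3_eq_neg_third_J3_0164 {F₀ : VecFn}
    (h3eq : ∀ x : Fin 3 → ℝ, (∀ i, (41 / 250 : ℝ) ≤ x i) → (∀ i, x i < 1 / 2) → ∑ i, x i = 1 → F₀ 3 x = -1) :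
    sliceIntegral 3 1 (fun v => if (∀ t, (41 / 250 : ℝ) ≤ v t) ∧ (∀ t, v t < 1 / 2) then
        F₀ 3 v / (3 * (v 0 * v 1 * v 2)) else 0) =
      -(1 / 3) * sliceIntegral 3 1 (fun v => if (∀ t, (41 / 250 : ℝ) ≤ v t) ∧ (∀ t, v t < 1 / 2) then
        1 / (v 0 * v 1 * v 2) else 0) := by
  rw [← sliceIntegral_const_mul]
  refine sliceIntegral_congr fun v hv hvs => ?_
  split_ifs with h
  · rw [h3eq v h.1 h.2 hvs]; ring
  · ring

/-- **`S₅ = -(1/20) ∫ 𝟙 F₀⁽⁵⁾/∏v`** for `F₀⁽⁵⁾` vanishing at vectors with two coordinates summing to `≥ 1/2`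
(on the rest of `Δ₅(1)` every pair is `< 1/2` and `𝓛_{1/2} = -6`, `w₅ = -1/(20 ∏ v)`).
[cite: FordMaynard2024PrimeSieves, §8 ("if x ∈ 𝓗₅ with every pair < 1/2 then 𝓛_{1/2}(x) = −6"; I₅ = −6∫)] -/
theorem S5_eq_0164 {F₀ : VecFn}
    (hpair : ∀ (x : Fin 5 → ℝ) (i j : Fin 5), i ≠ j → 1 / 2 ≤ x i + x j → F₀ 5 x = 0) :
    sliceIntegral 5 1 (fun v => if ∀ t, (41 / 250 : ℝ) ≤ v t then blockWeight (1 / 2) 5 v * F₀ 5 v else 0) =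
      -(1 / 20) * sliceIntegral 5 1 (fun v => if ∀ t, (41 / 250 : ℝ) ≤ v t then
        F₀ 5 v / (v 0 * v 1 * v 2 * v 3 * v 4) else 0) := by
  rw [← sliceIntegral_const_mul]
  refine sliceIntegral_congr fun v hv hvs => ?_
  split_ifs with h
  · by_cases hz : F₀ 5 v = 0
    · rw [hz]; ring
    · have hp : ∀ i j : Fin 5, i ≠ j → v i + v j < 1 - 1 / 2 := by
        intro i j hij
        by_contra hc
        exact hz (hpair v i j hij (by push Not at hc; linarith))
      rw [Fin.sum_univ_five] at hvs
      have h01 := hp 0 1 (by decide); have h02 := hp 0 2 (by decide); have h03 := hp 0 3 (by decide)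
      have h04 := hp 0 4 (by decide); have h12 := hp 1 2 (by decide); have h13 := hp 1 3 (by decide)
      have h14 := hp 1 4 (by decide); have h23 := hp 2 3 (by decide); have h24 := hp 2 4 (by decide)
      have h34 := hp 3 4 (by decide)
      have ht : ∀ i j k : Fin 5, i ≠ j → i ≠ k → j ≠ k → 1 - 1 / 2 ≤ v i + v j + v k := by
        intro i j k hij hik hjk
        fin_cases i <;> fin_cases j <;> fin_cases k <;> simp at hij hik hjk ⊢ <;> linarith
      rw [blockWeight_five_eq v hp ht]
      ring
  · ring

/-- `(v, b) ∈ ℝ⁴` for `v, b ∈ ℝ²`, as a vector literal. [folklore] -/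
theorem append_two_two_eq (v b : Fin 2 → ℝ) : Fin.append v b = ![v 0, v 1, b 0, b 1] := by
  ext i
  fin_cases i
  · rfl
  · rfl
  · rfl
  · rfl

/-- **The `n = 2` piece of `f_{2,1}` is `F₄(α)/α`**: for data with `F₀⁽⁴⁾ = -1` at the small vectors of the
support and `b ∈ [ν, 1/2)²`, `α = 1 - |b|`, the `n = 2` slice term equals `(1/2)∫_{Δ₂(α)} 𝟙[ν ≤ vᵢ < 1/2]/(v₀v₁)`.
[cite: FordMaynard2024PrimeSieves, §8 ("f_{2,1}(β₁,β₂,α) = F₄(α) − F₅(β₁,β₂)")] -/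
theorem pieceTwo_family_two_eq_0164 {F₀ : VecFn}
    (h4eq : ∀ x : Fin 4 → ℝ, (∀ i, (41 / 250 : ℝ) ≤ x i) → (∀ i, x i < 1 / 2) → ∑ i, x i = 1 → F₀ 4 x = -1)
    (b : Fin 2 → ℝ) (hb : ∀ i, (41 / 250 : ℝ) ≤ b i) (hb' : ∀ i, b i < 1 / 2) (hbs : ∑ i, b i ≤ 1 / 2) :
    sliceIntegral 2 (1 - ∑ i, b i) (fun v => if ∀ t, (41 / 250 : ℝ) ≤ v t then
        blockWeight (1 / 2) 2 v * F₀ (2 + 2) (Fin.append v b) else 0) =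
      1 / 2 * sliceIntegral 2 (1 - ∑ i, b i) (fun v =>
        if (∀ i, (41 / 250 : ℝ) ≤ v i) ∧ (∀ i, v i < 1 / 2) then 1 / (v 0 * v 1) else 0) := by
  rw [Fin.sum_univ_two] at hbs
  rw [← sliceIntegral_const_mul]
  refine sliceIntegral_congr fun v hv hvs => ?_
  rw [Fin.sum_univ_two] at hvs
  rw [Fin.sum_univ_two] at hvs
  by_cases h1 : ∀ t, (41 / 250 : ℝ) ≤ v t
  · rw [if_pos h1]
    by_cases h2 : ∀ i, v i < 1 / 2
    · have hb0 := hb 0; have hb1 := hb 1; have hb0' := hb' 0; have hb1' := hb' 1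
      rw [if_pos ⟨h1, h2⟩, blockWeight_two_eq v (by linarith [h2 0]) (by linarith [h2 1]) (by linarith),
        h4eq (Fin.append v b) ?_ ?_ ?_]
      · have := hv 0; have := hv 1
        field_simp
      · intro i
        have := h1 0; have := h1 1
        rw [append_two_two_eq]
        fin_cases i <;> simp <;> assumption
      · intro i
        have := h2 0; have := h2 1
        rw [append_two_two_eq]
        fin_cases i <;> simp <;> linarith
      · rw [append_two_two_eq, Fin.sum_univ_four]
        simp only [Matrix.cons_val_zero, Matrix.cons_val_one, Matrix.cons_val_two, Matrix.cons_val_three,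
          Matrix.head_cons, Matrix.tail_cons]
        linarith
    · rw [if_neg (fun h => h2 h.2), mul_zero]
      push Not at h2
      obtain ⟨i, hi⟩ := h2
      unfold blockWeight
      rw [linnikFn_eq_zero_of_mem (1 - 1 / 2) v (Finset.mem_univ i) (by linarith) fun k _ => (hv k).le,
        zero_div, zero_mul]
  · rw [if_neg h1, if_neg (fun h => h1 h.1), mul_zero]

/-- **The `n = 3` piece of `f_{2,1}` is `-F₅/α`**: for `F₀⁽⁵⁾` vanishing at vectors with a pair summing to
`≥ 1/2`, the `n = 3` slice term over `Δ₃(α)` (`α ≥ 1/2`) equals `-(1/6)∫ 𝟙[v ≥ ν] F₀⁽⁵⁾(v, b)/(v₀v₁v₂)`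
(where `F₀⁽⁵⁾(v,b) ≠ 0` all pairs of `v` are `< 1/2`, so `𝓛_{1/2}(v) = -1`).
[cite: FordMaynard2024PrimeSieves, §8 (F₅(β₁,β₂))] -/
theorem pieceThree_family_two_eq_0164 {F₀ : VecFn}
    (hpair : ∀ (x : Fin 5 → ℝ) (i j : Fin 5), i ≠ j → 1 / 2 ≤ x i + x j → F₀ 5 x = 0)
    {α : ℝ} (hα : 1 / 2 ≤ α) (b : Fin 2 → ℝ) :
    sliceIntegral 3 α (fun v => if ∀ t, (41 / 250 : ℝ) ≤ v t then
        blockWeight (1 / 2) 3 v * F₀ (3 + 2) (Fin.append v b) else 0) =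
      -(1 / 6) * sliceIntegral 3 α (fun v => if ∀ t, (41 / 250 : ℝ) ≤ v t then
        F₀ (3 + 2) (Fin.append v b) / (v 0 * v 1 * v 2) else 0) := by
  rw [← sliceIntegral_const_mul]
  refine sliceIntegral_congr fun v hv hvs => ?_
  rw [Fin.sum_univ_three] at hvs
  split_ifs with h
  · by_cases hz : F₀ (3 + 2) (Fin.append v b) = 0
    · rw [hz]; ring
    · have hp : ∀ i j : Fin 3, i ≠ j → v i + v j < 1 - 1 / 2 := by
        intro i j hij
        by_contra hc
        have := hpair (Fin.append v b) (Fin.castAdd 2 i) (Fin.castAdd 2 j)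
          (fun h => hij (Fin.castAdd_inj.1 h))
        rw [Fin.append_left, Fin.append_left] at this
        exact hz (this (by push Not at hc; linarith))
      have h0 := hv 0; have h1 := hv 1; have h2 := hv 2
      rw [blockWeight_three_eq_neg v (fun i => by
          fin_cases i
          · have := hp 0 1 (by decide); simp; linarith
          · have := hp 0 1 (by decide); simp; linarith
          · have := hp 0 2 (by decide); simp; linarith) (by linarith)
        (hp 0 1 (by decide)) (hp 0 2 (by decide)) (hp 1 2 (by decide))]
      field_simp
  · ring

/-- **`stub_tweakNeg0164` from the witness shape and two explicit inequalities.** Let `F₀ ∈ 𝒮` be piecewise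
Lipschitz in each dimension, supported on `{ξᵢ ≥ 41/250, Σ ξ = 1}`, with `F₀⁽³⁾, F₀⁽⁴⁾` equal to `-1` at the small
vectors of the support and in `[-1, 0]` everywhere, `F₀⁽⁵⁾ ≥ 0` vanishing at vectors with a pair `≥ 1/2`, `F₀⁽⁶⁾ = 0`.
If (I) `(1/3) J₃ + (1/20)∫_{Δ₅(1)} 𝟙[v ≥ ν] F₀⁽⁵⁾/∏v > 1` and (II) for all `b ∈ [ν, 1/2)²` with `|b| ≤ 1/2`,
`α = 1 - |b|`: `(α/6)∫_{Δ₃(α)} 𝟙[v ≥ ν] F₀⁽⁵⁾(v, b)/(v₀v₁v₂) ≤ 1 + (α/2)∫_{Δ₂(α)} 𝟙[ν ≤ vᵢ < 1/2]/(v₀v₁)`, then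
`F₀` witnesses `stub_tweakNeg0164` verbatim.  (For the cell's LP optimum: `J₃/3 = 0.85684`, the `F₀⁽⁵⁾` term
`= 0.1476`, sum `1.0045`; (II) holds with slack `4.0·10⁻³`.)
[cite: FordMaynard2024PrimeSieves, §8 (proof of Theorem 2.7 (c))] -/
theorem stub_tweakNeg0164_of_explicit (F₀ : VecFn) (hs : F₀.IsSymmetric)
    (hpl : ∀ k, IsPiecewiseLipschitz (F₀ k))
    (hsupp : ∀ (k : ℕ) (ξ : Fin k → ℝ), F₀ k ξ ≠ 0 → (∀ i, (41 / 250 : ℝ) ≤ ξ i) ∧ ∑ i, ξ i = 1)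
    (h3eq : ∀ x : Fin 3 → ℝ, (∀ i, (41 / 250 : ℝ) ≤ x i) → (∀ i, x i < 1 / 2) → ∑ i, x i = 1 → F₀ 3 x = -1)
    (h4eq : ∀ x : Fin 4 → ℝ, (∀ i, (41 / 250 : ℝ) ≤ x i) → (∀ i, x i < 1 / 2) → ∑ i, x i = 1 → F₀ 4 x = -1)
    (h3 : ∀ x : Fin 3 → ℝ, -1 ≤ F₀ 3 x ∧ F₀ 3 x ≤ 0) (h4 : ∀ x : Fin 4 → ℝ, -1 ≤ F₀ 4 x ∧ F₀ 4 x ≤ 0)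
    (h5 : ∀ x : Fin 5 → ℝ, 0 ≤ F₀ 5 x)
    (hpair : ∀ (x : Fin 5 → ℝ) (i j : Fin 5), i ≠ j → 1 / 2 ≤ x i + x j → F₀ 5 x = 0)
    (h6 : ∀ x : Fin 6 → ℝ, F₀ 6 x = 0)
    (hI : 1 < 1 / 3 * sliceIntegral 3 1 (fun v => if (∀ t, (41 / 250 : ℝ) ≤ v t) ∧ (∀ t, v t < 1 / 2) then
          1 / (v 0 * v 1 * v 2) else 0) +
        1 / 20 * sliceIntegral 5 1 (fun v => if ∀ t, (41 / 250 : ℝ) ≤ v t then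
          F₀ 5 v / (v 0 * v 1 * v 2 * v 3 * v 4) else 0))
    (hII : ∀ b : Fin 2 → ℝ, (∀ i, (41 / 250 : ℝ) ≤ b i) → (∀ i, b i < 1 / 2) → ∑ i, b i ≤ 1 / 2 →
      (1 - ∑ i, b i) / 6 * sliceIntegral 3 (1 - ∑ i, b i) (fun v => if ∀ t, (41 / 250 : ℝ) ≤ v t then
          F₀ (3 + 2) (Fin.append v b) / (v 0 * v 1 * v 2) else 0) ≤
        1 + (1 - ∑ i, b i) / 2 * sliceIntegral 2 (1 - ∑ i, b i) (fun v =>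
          if (∀ i, (41 / 250 : ℝ) ≤ v i) ∧ (∀ i, v i < 1 / 2) then 1 / (v 0 * v 1) else 0)) :
    ∃ F₀ : VecFn, F₀.IsSymmetric ∧ (∀ k, IsPiecewiseLipschitz (F₀ k)) ∧
      (∀ (k : ℕ) (ξ : Fin k → ℝ), F₀ k ξ ≠ 0 → (∀ i, (41 / 250 : ℝ) ≤ ξ i) ∧ ∑ i, ξ i = 1) ∧
      tweak (1 / 2) (41 / 250) Fin.elim0 Fin.elim0 F₀ 1 (fun _ => 1) < -1 ∧
      ∀ k : ℕ, 2 ≤ k → ∀ β : Fin k → ℝ, -1 ≤ tweak (1 / 2) (41 / 250) Fin.elim0 Fin.elim0 F₀ k β := by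
  refine stub_tweakNeg0164_of_shape'' F₀ hs hpl hsupp h3eq h3 h4 h5 hpair h6 ?_ (fun b hb hb' hbs => ?_)
  · rw [T3_eq_neg_third_J3_0164 h3eq, S5_eq_0164 hpair]
    linarith
  · rw [pieceTwo_family_two_eq_0164 h4eq b hb hb' hbs, pieceThree_family_two_eq_0164 hpair (by linarith) b]
    have := hII b hb hb' hbs
    nlinarith

end Summit.Parity.GeneralizedHardyLittlewood.FordMaynardNoSieveConst0164NegWitness0164

end
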